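import Literature.Algebra.Homology.ContCohomologyCrossedHomPrincipal
import Literature.NumberTheory.GaloisRepresentations.ContinuousH1
import Literature.AnabelianGeometry.AbsoluteAnabelian.AbsTopIII.Thm19cProofs
import Literature.AnabelianGeometry.AbsoluteAnabelian.AbsTopIII.Thm19CuspidalDegreeProofs
import HarnessLib

/-!
# [AbsTopIII] Thm. 1.9 (c): the integral cuspidal degree of a class at a cusp is UNIQUE
# (`H¹(I_z, M_Z) = Hom_cont(I_z, M_Z)` for the trivial `I_z`-action) — proof-only companion

Mochizuki, *Topics in Absolute Anabelian Geometry III*, §1, Prop. 1.6 (iii), manuscript p. 35 (lit key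
`paper:url-5493eb38cbb7`): "restricting cohomology classes of `Π_U` to the various `I_x` for `x ∈ S`
[...] yields a natural exact sequence `1 → (k^×)^∧ → H¹(Π_U, M_X) → ⊕_{x ∈ S} Ẑ` — where we identify
`Hom_Ẑ(I_x, M_X)` with `Ẑ` via the isomorphism `I_x ⥲ M_X` of Proposition 1.4, (ii)", and Thm. 1.9
(b)–(c) p. 37 ("the natural isomorphisms `I_z ⥲ μ_Ẑ(Π_U) := M_Z`"; "the subgroup `P_U` [...] determined by
the cuspidal principal divisors via the isomorphisms of (b)").  The identification `H¹(I_x, M_X) =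
Hom(I_x, M_X)` used in that sentence is the classical `H¹ = Hom_cont` for a TRIVIAL action
([cite: SerreGaloisCohomology1997, I §2.3]); `I_x ⊆ Δ_U` acts trivially on `M_X` (tree:
`cyclotomeModRep_of_mem_geom`).

abc-iut sub-DAG `plan/L4/SUBDAG-AbsTopIII-Thm19.md` (holder abc-iut-w5-d213), LAYER V row
«Thm19-LV-DUNIQUE» (abc-iut-L4-lead RULING #5j (2), seat abc-iut-L4-t4): abc-iut-w5-d213's
`CurveModel.HasCuspidalDegree P η z n` (`Thm19CuspidalDegree.lean`) says that the restriction of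
`η ∈ H¹(Π_U, M_Z)` to `I_z` is the class of the continuous homomorphism `i ↦ n · sync_z(i)`; this file
proves that the degree `n` is UNIQUE, so that the degree function `D` of `PUgt` is well defined.
Contents (all theorems; no definition, no named fact):

* generic bridge (`ContinuousCohomology` namespace): the class map
  `ContinuousCohomology.crossedHomClass` of `Literature/Algebra/Homology/ContCohomologyCrossedHomClass`
  COINCIDES with the class map `oneCocycleClass` of
  `Literature/NumberTheory/GaloisRepresentations/ContinuousH1` (`crossedHomClass_eq_oneCocycleClass`) —
  both are `homologyπ` of the homogeneous cocycle `(x, y) ↦ f y − f x`; hence `crossedHomClass_sub`,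
  surjectivity `exists_crossedHomClass_eq`, and for a TRIVIAL action injectivity
  `eq_of_crossedHomClass_eq` (`H¹(G, X) = Hom_cont(G, X)`: the «π = 0 ⇒ boundary» step is the tree's
  `eq_zero_of_crossedHomClass_eq_zero`, `ContCohomologyCrossedHomPrincipal.lean`);
* `CurveModel.inertiaRep_ρ_apply` — `I_z` acts trivially on `M_Z` (restriction of the `Π_Z`-module
  `M_Z` along `I_z ⊆ Δ_U ⊆ Π_U → Π_Z`);
* `CurveModel.CuspSyncPresentation.exists_ne_one_Icusp` — `I_z ≠ 1` (it is carried bijectively onto the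
  free procyclic inertia group of the presentation `U ⊆ Z ∖ {z} ⊆ Z`, Prop. 1.4 (i));
* `CyclotomeMod.eq_zero_of_zsmul_eq_zero` — `M_Z = Hom(H²(Δ_Z, Ẑ), Ẑ)` is `ℤ`-torsion-free;
* **`CurveModel.HasCuspidalDegree.eq_zero_of_zero`** (`0` has only the degree `0`) and
  **`CurveModel.HasCuspidalDegree.unique`**: `HasCuspidalDegree P η z n → HasCuspidalDegree P η z n' →
  n = n'`, under the injectivity of THE synchronization `sync_z` (abc-iut-w5-d213's
  `syncAt_bijective` from abc-iut-L4-t1's `Thm_1_9_b_natural`; corollary `unique_of_thm19bNatural`).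

HONEST FRAMING: classical continuous-cohomology bookkeeping for a refereed, undisputed result; typed ≠
proved elsewhere; nothing here bears on [IUTchIII] Cor. 3.12.
-/

noncomputable section

open CategoryTheory
open scoped Classical Pointwise

/-! ### Generic: the two class maps of the tree agree; `H¹ = Hom_cont` for a trivial action -/

namespace ContinuousCohomology

open TopRep ContRepresentation Literature.NumberTheory.GaloisRepresentations

universe u v

variable {k : Type u} [Ring k] [TopologicalSpace k]
variable {G : Type v} [Group G] [TopologicalSpace G] [IsTopologicalGroup G]
variable (X : TopRep.{v} k G)

omit [IsTopologicalGroup G] in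
/-- The difference of two continuous crossed homomorphisms is a crossed homomorphism.
[cite: SerreGaloisCohomology1997, I §2.3] -/
theorem crossedHom_sub {f f' : C(G, X)} (hf : ∀ x y, f (x * y) = f x + X.ρ x (f y))
    (hf' : ∀ x y, f' (x * y) = f' x + X.ρ x (f' y)) (x y : G) :
    (f - f') (x * y) = (f - f') x + X.ρ x ((f - f') y) := by
  simp only [ContinuousMap.sub_apply, hf, hf', map_sub]
  abel

/-- **The two `H¹`-class maps of the tree agree**: the class `crossedHomClass X f hf` of a continuous
crossed homomorphism (`ContCohomologyCrossedHomClass.lean`, via Mathlib's abstract cycles object) equals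
`oneCocycleClass X ⟨f, hf⟩` (`ContinuousH1.lean`, via the concrete kernel of `d¹`): both are the image under
`homologyπ` of the homogeneous cocycle `(x, y) ↦ f y − f x`. [cite: SerreGaloisCohomology1997, I §2.3] -/
theorem crossedHomClass_eq_oneCocycleClass (f : C(G, X)) (hf : ∀ x y, f (x * y) = f x + X.ρ x (f y)) :
    crossedHomClass X f hf = oneCocycleClass X ⟨f, hf⟩ := by
  unfold crossedHomClass oneCocycleClass
  have h1 := homologyπ_eq_cxClass (homogeneousCochains X) 1 2 up_nat_next_one (crossedHomCocycle X f hf)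
  change ((homogeneousCochains X).homologyπ 1) (crossedHomCocycle X f hf) = _
  rw [h1]
  apply cxClass_congr
  apply Subtype.ext
  change (((homogeneousCochains X).iCycles 1).hom (crossedHomCocycle X f hf)).1 = _
  rw [iCycles_crossedHomCocycle, coe_toOneCochain]
  ext x y
  rw [twoOf_apply, d_one_hom_apply]

/-- `[f − f'] = [f] − [f']` in `H¹(G, X)`. [cite: SerreGaloisCohomology1997, I §2.3] -/
theorem crossedHomClass_sub (f f' : C(G, X)) (hf : ∀ x y, f (x * y) = f x + X.ρ x (f y))
    (hf' : ∀ x y, f' (x * y) = f' x + X.ρ x (f' y)) :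
    crossedHomClass X (f - f') (crossedHom_sub X hf hf') =
      crossedHomClass X f hf - crossedHomClass X f' hf' := by
  rw [crossedHomClass_eq_oneCocycleClass, crossedHomClass_eq_oneCocycleClass,
    crossedHomClass_eq_oneCocycleClass, ← oneCocycleClass_sub]
  rfl

/-- **Every class of `H¹(G, X)` is the class of a continuous crossed homomorphism** (surjectivity of the
comparison map `crossedHomClass`). [cite: SerreGaloisCohomology1997, I §2.3] -/
theorem exists_crossedHomClass_eq (γ : continuousCohomology 1 X) :
    ∃ (f : C(G, X)) (hf : ∀ x y, f (x * y) = f x + X.ρ x (f y)), crossedHomClass X f hf = γ := by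
  obtain ⟨φ, rfl⟩ := oneCocycleClass_surjective X γ
  exact ⟨φ.1, φ.2, crossedHomClass_eq_oneCocycleClass X φ.1 φ.2⟩

/-- **`H¹(G, X) = Hom_cont(G, X)` for a TRIVIAL action, injectivity half**: two continuous crossed
homomorphisms (= continuous homomorphisms) with the same class are equal. [cite: SerreGaloisCohomology1997, I §2.3] -/
theorem eq_of_crossedHomClass_eq (htriv : ∀ (g : G) (x : X), X.ρ g x = x) {f f' : C(G, X)}
    (hf : ∀ x y, f (x * y) = f x + X.ρ x (f y)) (hf' : ∀ x y, f' (x * y) = f' x + X.ρ x (f' y))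
    (h : crossedHomClass X f hf = crossedHomClass X f' hf') : f = f' := by
  have h0 : crossedHomClass X (f - f') (crossedHom_sub X hf hf') = 0 := by
    rw [crossedHomClass_sub X f f' hf hf', h, sub_self]
  exact sub_eq_zero.mp (eq_zero_of_crossedHomClass_eq_zero X htriv (f - f') (crossedHom_sub X hf hf') h0)

end ContinuousCohomology

/-! ### [AbsTopIII] Thm. 1.9 (c): uniqueness of the integral cuspidal degree -/

namespace Literature.AnabelianGeometry.AbsoluteAnabelian.AbsTopIII

universe u

/-- **`M_X(Ẑ) = Hom(H²(Δ_X, Ẑ), Ẑ)` is `ℤ`-torsion-free**: `d • m = 0` with `m ≠ 0` forces `d = 0` (each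
`ℤ_p` is a domain of characteristic `0`). [cite: MochizukiAbsTopIII2015, Prop 1.4 (ii) p.31] -/
theorem CyclotomeMod.eq_zero_of_zsmul_eq_zero (E : FundamentalExtension.{u}) {d : ℤ}
    {m : CyclotomeMod E ZHatCoeff.{u}} (h : d • m = 0) (hm : m ≠ 0) : d = 0 := by
  by_contra hd
  apply hm
  have hev : CyclotomeMod.evalHom E ZHatCoeff.{u} (d • m) = d • CyclotomeMod.evalHom E ZHatCoeff.{u} m :=
    map_zsmul _ d m
  rw [h, map_zero] at hev
  apply LinearMap.ext
  intro ξ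
  -- `(d • m) ξ = d • m ξ = 0`, read off the evaluation homomorphism
  have hξ : d • (m.toDual ξ) = 0 := by
    have h1 : (d • CyclotomeMod.evalHom E ZHatCoeff.{u} m) ξ = 0 := by
      rw [← hev]
      rfl
    exact h1
  change m.toDual ξ = (0 : geomCyclotomeDual E ZHatCoeff.{u}) ξ
  rw [LinearMap.zero_apply]
  apply ULift.ext
  funext p
  have hp : d • ((m.toDual ξ).down p) = 0 := congrArg (fun c : ZHatCoeff.{u} => c.down p) hξ
  haveI : Fact (p : ℕ).Prime := ⟨p.2⟩
  rw [zsmul_eq_mul, mul_eq_zero] at hp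
  rcases hp with hp | hp
  · exact absurd (Int.cast_eq_zero.mp hp) hd
  · rw [hp]
    rfl

namespace CurveModel

variable {M : CurveModel.{u}} {U Z : M.Curve} {h : M.IsCofiniteOpen U Z} (P : M.CuspSyncPresentation h)

/-- **`I_z` acts trivially on `M_Z`**: the `I_z`-module `M.inertiaRep h z` (restriction of the
`Π_Z`-module `M_Z` along `I_z ⊆ Π_U → Π_Z`) has trivial action, since `I_z ⊆ Δ_U` maps into `Δ_Z`
(`Hom.mapsTo_geom`) and `Δ_Z` acts trivially (`cyclotomeModRep_of_mem_geom`).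
[cite: MochizukiAbsTopIII2015, Prop 1.4 (ii) p.31] -/
theorem inertiaRep_ρ_apply (h : M.IsCofiniteOpen U Z) (z : (M.cusps U).Cusp) (i : (M.cusps U).Icusp z)
    (m : M.inertiaRep h z) : (M.inertiaRep h z).ρ i m = m :=
  cyclotomeModRep_of_mem_geom (M.ext Z) ZHatCoeff.{u}
    ((M.res h).mapsTo_geom ((M.cusps U).Icusp_le_geom z i.2)) m

namespace CuspSyncPresentation

include P in
/-- **`I_z ≠ 1`** for a cusp `z` of `U` admitting a cyclotome presentation `U ⊆ Z ∖ {z} ⊆ Z`: `I_z` is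
carried bijectively (Prop. 1.4 (i), `inertiaTransport`) onto the inertia group of the presentation,
which is free procyclic ("`I_x ≅ Ẑ(1)`", field `isFreeProcyclic`) and so has an open subgroup of index
`2`. [cite: MochizukiAbsTopIII2015, Prop 1.4 (i) p.31] -/
theorem exists_ne_one_Icusp (z : (M.cusps U).Cusp) : ∃ i : (M.cusps U).Icusp z, i ≠ 1 := by
  -- the target inertia group is nontrivial
  have hne : ∃ j : (M.cusps (P.Uz z)).Icusp (P.cusp z), j ≠ 1 := by
    by_contra hall
    simp only [not_exists, ne_eq, not_not] at hall
    obtain ⟨H, -, hidx⟩ := (P.pres z).isFreeProcyclic.exists_isOpen_index 2 two_pos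
    haveI : Subsingleton ((M.cusps (P.Uz z)).Icusp (P.cusp z)) :=
      ⟨fun a b => (hall a).trans (hall b).symm⟩
    have htop : H = ⊤ := Subsingleton.elim _ _
    rw [htop, Subgroup.index_top] at hidx
    exact absurd hidx (by norm_num)
  obtain ⟨j, hj⟩ := hne
  obtain ⟨i, rfl⟩ := (P.inertiaTransport_bijective z).2 j
  exact ⟨i, fun hi => hj (by rw [hi, map_one])⟩

/-- For `i ∈ I_z`, `i ≠ 1`, THE synchronization does not vanish at `i` when it is injective.
[cite: MochizukiAbsTopIII2015, Thm 1.9 (b) p.37] -/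
theorem syncAt_ne_zero (z : (M.cusps U).Cusp) (hinj : Function.Injective (P.syncAt z))
    {i : (M.cusps U).Icusp z} (hi : i ≠ 1) : P.syncAt z (Additive.ofMul i) ≠ 0 := by
  intro h0
  apply hi
  have h1 : P.syncAt z (Additive.ofMul i) = P.syncAt z (Additive.ofMul 1) := by
    rw [h0, ofMul_one, map_zero]
  exact Additive.ofMul.injective (hinj h1)

end CuspSyncPresentation

/-- **The zero class has only the cuspidal degree `0`**: if `0 ∈ H¹(Π_U, M_Z)` has integral cuspidal degree
`d` at `z` (through THE synchronization of (b), assumed injective), then `d = 0` — because `I_z` acts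
trivially on `M_Z`, so `H¹(I_z, M_Z) = Hom_cont(I_z, M_Z)` (`ContinuousCohomology.eq_zero_of_crossedHomClass_eq_zero`)
and the homomorphism `i ↦ d · sync_z(i)` vanishes only for `d = 0` (`I_z ≠ 1`, `sync_z` injective, `M_Z`
torsion-free). [cite: MochizukiAbsTopIII2015, Prop 1.6 (iii) p.35] -/
theorem HasCuspidalDegree.eq_zero_of_zero {z : (M.cusps U).Cusp} (hinj : Function.Injective (P.syncAt z))
    {d : ℤ} (hd : HasCuspidalDegree P (0 : cyclotomeModH1 (M.res h) ZHatCoeff.{u}) z d) : d = 0 := by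
  obtain ⟨hc, hf, heq⟩ := hd
  have h0 : (cyclotomeModH1Res (M.res h) ZHatCoeff.{u} ((M.cusps U).Icusp z))
      (0 : cyclotomeModH1 (M.res h) ZHatCoeff.{u}) = 0 :=
    map_zero (cyclotomeModH1Res (M.res h) ZHatCoeff.{u} ((M.cusps U).Icusp z)).hom
  rw [h0] at heq
  have hzero := ContinuousCohomology.eq_zero_of_crossedHomClass_eq_zero (M.inertiaRep h z)
    (M.inertiaRep_ρ_apply h z) _ hf heq.symm
  obtain ⟨i, hi⟩ := P.exists_ne_one_Icusp z
  have hev : d • P.syncAt z (Additive.ofMul i) = 0 := by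
    have := congrArg (fun F : C((M.cusps U).Icusp z, M.inertiaRep h z) => F i) hzero
    simpa using this
  exact CyclotomeMod.eq_zero_of_zsmul_eq_zero (M.ext Z) hev (P.syncAt_ne_zero z hinj hi)

/-- **Uniqueness of the integral cuspidal degree** ([AbsTopIII] Prop. 1.6 (iii) / Thm. 1.9 (c): the
`x`-component of `H¹(Π_U, M_X) → ⊕_{x ∈ S} Ẑ`, "where we identify `Hom_Ẑ(I_x, M_X)` with `Ẑ` via the
isomorphism `I_x ⥲ M_X`", is a well-defined number): if `η` has cuspidal degrees `n` and `n'` at `z`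
(read through THE synchronization `sync_z` of (b), assumed injective) then `n = n'`.
[cite: MochizukiAbsTopIII2015, Thm 1.9 (c) p.37] -/
theorem HasCuspidalDegree.unique {η : cyclotomeModH1 (M.res h) ZHatCoeff.{u}} {z : (M.cusps U).Cusp}
    (hinj : Function.Injective (P.syncAt z)) {n n' : ℤ} (hn : HasCuspidalDegree P η z n)
    (hn' : HasCuspidalDegree P η z n') : n = n' := by
  have hsub : HasCuspidalDegree P (η - η) z (n - n') := HasCuspidalDegree.sub P hn hn'
  rw [sub_self] at hsub
  exact sub_eq_zero.mp (HasCuspidalDegree.eq_zero_of_zero P hinj hsub)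

/-- Uniqueness of the integral cuspidal degree at every cusp, from abc-iut-L4-t1's natural single-cusp
form of Thm. 1.9 (b) (`Thm_1_9_b_natural`: THE synchronization of a cyclotome presentation is bijective),
via abc-iut-w5-d213's `syncAt_bijective`. [cite: MochizukiAbsTopIII2015, Thm 1.9 (c) p.37] -/
theorem HasCuspidalDegree.unique_of_thm19bNatural (h9 : M.Thm_1_9_b_natural)
    {η : cyclotomeModH1 (M.res h) ZHatCoeff.{u}} {z : (M.cusps U).Cusp} {n n' : ℤ}
    (hn : HasCuspidalDegree P η z n) (hn' : HasCuspidalDegree P η z n') : n = n' :=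
  HasCuspidalDegree.unique P (P.syncAt_bijective h9 z).1 hn hn'

/-- The DEGREE FUNCTION of a class is unique: if `D` and `D'` both give integral cuspidal degrees of `η`
at every cusp of `U` (as in the definition of the group-theoretic `P_U`, `IntrinsicKummerModel.PUgt`),
then `D = D'` (all synchronizations injective). [cite: MochizukiAbsTopIII2015, Thm 1.9 (c) p.37] -/
theorem HasCuspidalDegree.degreeFun_unique (hinj : ∀ z, Function.Injective (P.syncAt z))
    {η : cyclotomeModH1 (M.res h) ZHatCoeff.{u}} {D D' : (M.cusps U).Cusp → ℤ}
    (hD : ∀ z, HasCuspidalDegree P η z (D z)) (hD' : ∀ z, HasCuspidalDegree P η z (D' z)) : D = D' :=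
  funext fun z => HasCuspidalDegree.unique P (hinj z) (hD z) (hD' z)

/-- The degree function of a class is unique, from `Thm_1_9_b_natural` (all synchronizations bijective).
[cite: MochizukiAbsTopIII2015, Thm 1.9 (c) p.37] -/
theorem HasCuspidalDegree.degreeFun_unique_of_thm19bNatural (h9 : M.Thm_1_9_b_natural)
    {η : cyclotomeModH1 (M.res h) ZHatCoeff.{u}} {D D' : (M.cusps U).Cusp → ℤ}
    (hD : ∀ z, HasCuspidalDegree P η z (D z)) (hD' : ∀ z, HasCuspidalDegree P η z (D' z)) : D = D' :=
  HasCuspidalDegree.degreeFun_unique P (fun z => (P.syncAt_bijective h9 z).1) hD hD'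

/-- **(D-unique) in the shape consumed by the LAYER V (e)-bridge of sub-DAG Thm 1.9** (abc-iut-w5-d213):
for a system of cyclotome presentations `P` of a model satisfying `Thm_1_9_b_natural`, the integral
cuspidal degree of a class `η ∈ H¹(Π_U, M_Z)` at a cusp `z` is unique.
[cite: MochizukiAbsTopIII2015, Thm 1.9 (c) p.37] -/
theorem CuspSyncPresentation.hasCuspidalDegree_unique (h9 : M.Thm_1_9_b_natural)
    {η : cyclotomeModH1 (M.res h) ZHatCoeff.{u}} {z : (M.cusps U).Cusp} {n m : ℤ} :
    HasCuspidalDegree P η z n → HasCuspidalDegree P η z m → n = m :=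
  fun hn hm => HasCuspidalDegree.unique P (P.syncAt_bijective h9 z).1 hn hm

end CurveModel

end Literature.AnabelianGeometry.AbsoluteAnabelian.AbsTopIII

end
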